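import Summits.NavierStokesRegularity.NavierStokesRegularity.Theorems.SoloRefuteKyritsis2022Shear
import HarnessLib

/-!
# NS-claims map, C03 (Kyritsis 2022), part 3/3: trajectory maps of the shear flow; `not_Theorem44Infinite`, `not_Step_11`, `not_Step_10`

Third of the three files into which ns-claims-refuter-1's kernel checks of the typed skeleton
`Literature.Claims.NS.Kyritsis2022` are split (gate lint: Theorems files with proofs ≤ 400 lines;
filed for the author by ns-claims-salvage-p4, content unchanged except one duplicated private
one-line helper `hasFDerivAt_coord`). Parts 1–2: `SoloRefuteKyritsis2022.lean` (toolkit, static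
countermodel, `not_Step_6`, description of all countermodels), `SoloRefuteKyritsis2022Shear.lean` (the
periodic Euler shear flow). This part: the explicit volume-preserving particle-trajectory map
`X(t,a) = (a₀ + t sin 2πa₁, a₁, a₂ + t sin 2πa₀)` and its inverse; `not_Theorem44Infinite` and
`not_Step_11` (Thm 4.4 «infinite time» clause, pp. 2553–2555: `sup|ω(0,·)| ≤ 4π`, `|ω(t,0)| ≥ 4π²t`);
`not_Step_10` ((4.13)→(4.14) pp. 2554–2555, literal round-ball reading: at the stagnation point `0`,
axis `−e₀`, radius `1/16`, the round-ball average is `0` at time `0` and `≥ π²/16` at time `1/16`).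
Print locators: K. E. Kyritsis, J. Appl. Math. Phys. 10 (2022) 2538–2560. Axioms: `propext`,
`Classical.choice`, `Quot.sound` only.
WHAT THIS IS NOT: not a claim about NS regularity or blow-up; not a claim about any author beyond
the typed locator.
-/


noncomputable section

open Real Set Function MeasureTheory InnerProductSpace
open Literature.Analysis.FluidPDE
open scoped ContDiff RealInnerProductSpace

-- The summit's canonical theorem namespace repeats the summit name (single-conjunct summit).
set_option linter.dupNamespace false

namespace Summit.NavierStokesRegularity.NavierStokesRegularity.Theorems.Kyritsis2022

/-- Coordinate projections are their own derivative. [folklore] -/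
private theorem hasFDerivAt_coord (j : Fin 3) (x : EuclideanSpace ℝ (Fin 3)) :
    HasFDerivAt (fun y : EuclideanSpace ℝ (Fin 3) => y j) (pr j) x :=
  (pr j).hasFDerivAt


/-! ### The particle-trajectory map of the shear flow -/

/-- The flow map `X(t,a) = (a₀ + t sin 2πa₁, a₁, a₂ + t sin 2πa₀)`. -/
def flowX (t : ℝ) (a : EuclideanSpace ℝ (Fin 3)) : EuclideanSpace ℝ (Fin 3) :=
  !₂[a 0 + t * sin (2 * π * a 1), a 1, a 2 + t * sin (2 * π * a 0)]

/-- Its inverse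
`Y(t,x) = (x₀ − t sin 2πx₁, x₁, x₂ − t sin 2π(x₀ − t sin 2πx₁))`. -/
def flowY (t : ℝ) (x : EuclideanSpace ℝ (Fin 3)) : EuclideanSpace ℝ (Fin 3) :=
  !₂[x 0 - t * sin (2 * π * x 1), x 1, x 2 - t * sin (2 * π * (x 0 - t * sin (2 * π * x 1)))]

/-- `X` in the standard basis. -/
theorem flowX_eq (t : ℝ) (a : EuclideanSpace ℝ (Fin 3)) :
    flowX t a = (a 0 + t * sin (2 * π * a 1)) • bv 0 + a 1 • bv 1
      + (a 2 + t * sin (2 * π * a 0)) • bv 2 := by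
  ext i
  fin_cases i <;> simp [flowX]

/-- `Y` in the standard basis. -/
theorem flowY_eq (t : ℝ) (x : EuclideanSpace ℝ (Fin 3)) :
    flowY t x = (x 0 - t * sin (2 * π * x 1)) • bv 0 + x 1 • bv 1
      + (x 2 - t * sin (2 * π * (x 0 - t * sin (2 * π * x 1)))) • bv 2 := by
  ext i
  fin_cases i <;> simp [flowY]

/-- `X(0,·) = id`. -/
theorem flowX_zero : flowX 0 = id := by
  funext a
  ext i
  fin_cases i <;> simp [flowX]

/-- `Y ∘ X = id` at every time. -/
theorem flowY_flowX (t : ℝ) (a : EuclideanSpace ℝ (Fin 3)) : flowY t (flowX t a) = a := by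
  ext i
  fin_cases i <;> simp [flowX, flowY]

/-- `X ∘ Y = id` at every time. -/
theorem flowX_flowY (t : ℝ) (x : EuclideanSpace ℝ (Fin 3)) : flowX t (flowY t x) = x := by
  ext i
  fin_cases i <;> simp [flowX, flowY]

/-- The origin is a stagnation point: `X(t,0) = 0`. -/
theorem flowX_origin (t : ℝ) : flowX t 0 = 0 := by
  ext i
  fin_cases i <;> simp [flowX]

/-- The space derivative of `X(t,·)`. -/
private theorem hasFDerivAt_flowX (t : ℝ) (a : EuclideanSpace ℝ (Fin 3)) :
    HasFDerivAt (flowX t)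
      ((pr 0 + t • (cos (2 * π * a 1) • ((2 * π) • pr 1))).smulRight (bv 0)
        + (pr 1).smulRight (bv 1)
        + (pr 2 + t • (cos (2 * π * a 0) • ((2 * π) • pr 0))).smulRight (bv 2)) a := by
  rw [show flowX t = fun a : EuclideanSpace ℝ (Fin 3) => (a 0 + t * sin (2 * π * a 1)) • bv 0
      + a 1 • bv 1 + (a 2 + t * sin (2 * π * a 0)) • bv 2 from funext (flowX_eq t)]
  have h0 := ((hasFDerivAt_coord 0 a).add
    (((hasFDerivAt_coord 1 a).const_mul (2 * π)).sin.const_mul t)).smul_const (bv 0)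
  have h1 := (hasFDerivAt_coord 1 a).smul_const (bv 1)
  have h2 := ((hasFDerivAt_coord 2 a).add
    (((hasFDerivAt_coord 0 a).const_mul (2 * π)).sin.const_mul t)).smul_const (bv 2)
  exact (h0.add h1).add h2

/-- The space derivative of `Y(t,·)`. -/
private theorem hasFDerivAt_flowY (t : ℝ) (x : EuclideanSpace ℝ (Fin 3)) :
    HasFDerivAt (flowY t)
      ((pr 0 - t • (cos (2 * π * x 1) • ((2 * π) • pr 1))).smulRight (bv 0)
        + (pr 1).smulRight (bv 1)
        + (pr 2 - t • (cos (2 * π * (x 0 - t * sin (2 * π * x 1))) •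
            ((2 * π) • (pr 0 - t • (cos (2 * π * x 1) • ((2 * π) • pr 1)))))).smulRight
            (bv 2)) x := by
  rw [show flowY t = fun x : EuclideanSpace ℝ (Fin 3) => (x 0 - t * sin (2 * π * x 1)) • bv 0
      + x 1 • bv 1 + (x 2 - t * sin (2 * π * (x 0 - t * sin (2 * π * x 1)))) • bv 2 from
    funext (flowY_eq t)]
  have h0 := ((hasFDerivAt_coord 0 x).sub
    (((hasFDerivAt_coord 1 x).const_mul (2 * π)).sin.const_mul t)).smul_const (bv 0)
  have h1 := (hasFDerivAt_coord 1 x).smul_const (bv 1)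
  have h2 := ((hasFDerivAt_coord 2 x).sub ((((hasFDerivAt_coord 0 x).sub
    (((hasFDerivAt_coord 1 x).const_mul (2 * π)).sin.const_mul t)).const_mul
      (2 * π)).sin.const_mul t)).smul_const (bv 2)
  exact (h0.add h1).add h2

/-- `X(t,·)` is smooth. -/
theorem contDiff_flowX (t : ℝ) : ContDiff ℝ ∞ (flowX t) := by
  rw [show flowX t = fun a : EuclideanSpace ℝ (Fin 3) => (a 0 + t * sin (2 * π * a 1)) • bv 0
      + a 1 • bv 1 + (a 2 + t * sin (2 * π * a 0)) • bv 2 from funext (flowX_eq t)]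
  have hc : ∀ j : Fin 3, ContDiff ℝ ∞ (fun a : EuclideanSpace ℝ (Fin 3) => a j) := fun j =>
    (pr j).contDiff
  exact ((((hc 0).add (contDiff_const.mul (contDiff_const.mul (hc 1)).sin)).smul
    contDiff_const).add ((hc 1).smul contDiff_const)).add
    (((hc 2).add (contDiff_const.mul (contDiff_const.mul (hc 0)).sin)).smul contDiff_const)

/-- `Y(t,·)` is smooth. -/
theorem contDiff_flowY (t : ℝ) : ContDiff ℝ ∞ (flowY t) := by
  rw [show flowY t = fun x : EuclideanSpace ℝ (Fin 3) => (x 0 - t * sin (2 * π * x 1)) • bv 0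
      + x 1 • bv 1 + (x 2 - t * sin (2 * π * (x 0 - t * sin (2 * π * x 1)))) • bv 2 from
    funext (flowY_eq t)]
  have hc : ∀ j : Fin 3, ContDiff ℝ ∞ (fun a : EuclideanSpace ℝ (Fin 3) => a j) := fun j =>
    (pr j).contDiff
  exact ((((hc 0).sub (contDiff_const.mul (contDiff_const.mul (hc 1)).sin)).smul
    contDiff_const).add ((hc 1).smul contDiff_const)).add
    (((hc 2).sub (contDiff_const.mul (contDiff_const.mul ((hc 0).sub
      (contDiff_const.mul (contDiff_const.mul (hc 1)).sin))).sin)).smul contDiff_const)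

/-- Jacobian table of `X(t,·)`: row `j` = `∂/∂aⱼ`, column `i` = component. -/
def jacX (t : ℝ) (a : EuclideanSpace ℝ (Fin 3)) : Fin 3 → Fin 3 → ℝ :=
  ![![1, 0, 2 * π * t * cos (2 * π * a 0)], ![2 * π * t * cos (2 * π * a 1), 1, 0], ![0, 0, 1]]

/-- Jacobian table of `Y(t,·)`: row `j` = `∂/∂xⱼ`, column `i` = component. -/
def jacY (t : ℝ) (x : EuclideanSpace ℝ (Fin 3)) : Fin 3 → Fin 3 → ℝ :=
  ![![1, 0, -(2 * π * t * cos (2 * π * (x 0 - t * sin (2 * π * x 1))))],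
    ![-(2 * π * t * cos (2 * π * x 1)), 1,
      4 * π ^ 2 * t ^ 2 * cos (2 * π * x 1) * cos (2 * π * (x 0 - t * sin (2 * π * x 1)))],
    ![0, 0, 1]]

/-- Entries of the space derivative of `X(t,·)`. -/
theorem fderiv_flowX_single (t : ℝ) (a : EuclideanSpace ℝ (Fin 3)) (j i : Fin 3) :
    fderiv ℝ (flowX t) a (EuclideanSpace.single j 1) i = jacX t a j i := by
  rw [(hasFDerivAt_flowX t a).fderiv]
  fin_cases j <;> fin_cases i <;> simp [jacX] <;> ring

/-- Entries of the space derivative of `Y(t,·)`. -/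
theorem fderiv_flowY_single (t : ℝ) (x : EuclideanSpace ℝ (Fin 3)) (j i : Fin 3) :
    fderiv ℝ (flowY t) x (EuclideanSpace.single j 1) i = jacY t x j i := by
  rw [(hasFDerivAt_flowY t x).fderiv]
  fin_cases j <;> fin_cases i <;> simp [jacY] <;> ring

/-- `X(t,·)` is volume preserving. -/
theorem det_fderiv_flowX (t : ℝ) (a : EuclideanSpace ℝ (Fin 3)) :
    (fderiv ℝ (flowX t) a).det = 1 := by
  rw [det_eq_clmEntry_poly]
  simp only [clmEntry, fderiv_flowX_single]
  simp [jacX]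

/-- `Y(t,·)` is volume preserving. -/
theorem det_fderiv_flowY (t : ℝ) (x : EuclideanSpace ℝ (Fin 3)) :
    (fderiv ℝ (flowY t) x).det = 1 := by
  rw [det_eq_clmEntry_poly]
  simp only [clmEntry, fderiv_flowY_single]
  simp [jacY]

/-- The trajectory equation `∂ₜX(t,a) = u(t, X(t,a))`. -/
theorem hasDerivAt_flowX (t : ℝ) (a : EuclideanSpace ℝ (Fin 3)) :
    HasDerivAt (fun s => flowX s a) (shear t (flowX t a)) t := by
  have e : (fun s => flowX s a) = fun s =>
      (a 0 + s * sin (2 * π * a 1)) • bv 0 + a 1 • bv 1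
        + (a 2 + s * sin (2 * π * a 0)) • bv 2 :=
    funext fun s => flowX_eq s a
  rw [e]
  have h0 := (((hasDerivAt_id' t).mul_const (sin (2 * π * a 1))).const_add (a 0)).smul_const (bv 0)
  have h1 := hasDerivAt_const t (a 1 • bv 1)
  have h2 := (((hasDerivAt_id' t).mul_const (sin (2 * π * a 0))).const_add (a 2)).smul_const (bv 2)
  refine ((h0.add h1).add h2).congr_deriv ?_
  rw [shear_eq]
  ext i
  fin_cases i <;> simp [flowX]

/-- **The shear flow carries particle-trajectory maps** in the typed sense, on any time set. -/
theorem isFlowOn_shear (S : Set ℝ) :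
    Literature.Claims.NS.Kyritsis2022.IsFlowOn S shear flowX flowY where
  contDiff t _ := contDiff_flowX t
  contDiff_inv t _ := contDiff_flowY t
  hasDeriv t _ a := (hasDerivAt_flowX t a).hasDerivWithinAt
  initial := flowX_zero
  leftInv t _ a := flowY_flowX t a
  rightInv t _ x := flowX_flowY t x
  det t _ a := det_fderiv_flowX t a
  det_inv t _ x := det_fderiv_flowY t x

/-! ### `Theorem44Infinite` and `Step_11` -/

/-- **The «infinite time» clause of the typed Thm 4.4 is false** within its printed scope (Euler,
periodic case, p. 2553: «periodic or non-periodic»; Remark 4.3 p. 2555: no finite energy used).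
Locator: Kyritsis 2022, Thm 4.4 (infinite-time clause), pp. 2553–2555, and the abstract p. 2538;
skeleton decl `Literature.Claims.NS.Kyritsis2022.Theorem44Infinite`. Countermodel: the global
smooth `ℤ³`-periodic Euler shear flow above (`ν = 0`, no force, zero pressure, explicit
volume-preserving trajectory maps on every `[0,t]`, `sup|ω(0,·)| ≤ 4π`) has
`|ω(t,0)| ≥ 4π²t`, unbounded over `t ≥ 0`. Axioms: propext, Classical.choice, Quot.sound. -/
theorem not_Theorem44Infinite : ¬ Literature.Claims.NS.Kyritsis2022.Theorem44Infinite := by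
  intro h
  obtain ⟨M, hM⟩ := h 0 le_rfl shear (fun _ _ => 0)
    (isClassicalNSSolutionOn_shear (uniqueDiffOn_Ici 0))
    (fun t _ => ⟨flowX, flowY, isFlowOn_shear (Icc 0 t)⟩) bddAbove_norm_curl_shear_zero
  have h1 := le_norm_curl_shear_origin (t := |M| + 1) (by positivity)
  have h2 := hM (|M| + 1) (by positivity) 0
  have hπ : (4 : ℝ) ≤ 4 * π ^ 2 := by nlinarith [Real.pi_gt_three]
  have hM' : M ≤ |M| := le_abs_self M
  nlinarith [abs_nonneg M]

/-- **`Step_11` (Thm 4.4 as printed, both clauses) is false**: its second conjunct is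
`Theorem44Infinite`. Locator: Kyritsis 2022, Thm 4.4, pp. 2553–2555; skeleton decl
`Literature.Claims.NS.Kyritsis2022.Step_11` (consumed by `claim_of_thm44`). Axioms: propext,
Classical.choice, Quot.sound. -/
theorem not_Step_11 : ¬ Literature.Claims.NS.Kyritsis2022.Step_11 := fun h =>
  not_Theorem44Infinite h.2

/-! ### `Step_10`: the round-ball average along a trajectory is NOT non-increasing -/

/-- The integrand of the round-ball average for the axis `−e₀`:
`⟪ω(t,y), −e₀⟫ = 4π²t cos(2πy₁) cos(2π(y₀ − t sin 2πy₁))`. -/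
theorem inner_curl_shear_neg_bv0 (t : ℝ) (y : EuclideanSpace ℝ (Fin 3)) :
    ⟪curl (shear t) y, -bv 0⟫ =
      4 * π ^ 2 * t * cos (2 * π * y 1) * cos (2 * π * (y 0 - t * sin (2 * π * y 1))) := by
  rw [inner_neg_right, inner_bv_right, curl_shear]
  simp

/-- `cos θ ≥ 1/2` for `|θ| ≤ π/3`. [folklore] -/
theorem half_le_cos {θ : ℝ} (h : |θ| ≤ π / 3) : 1 / 2 ≤ cos θ := by
  rw [← Real.cos_pi_div_three, ← Real.cos_abs θ]
  exact Real.cos_le_cos_of_nonneg_of_le_pi (abs_nonneg θ)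
    (by linarith [Real.pi_pos]) h

/-- On the ball `B(0, 1/16)` at time `t = 1/16` the integrand is at least `π²/16`. -/
theorem integrand_lower_bound {y : EuclideanSpace ℝ (Fin 3)}
    (hy : y ∈ Metric.ball (0 : EuclideanSpace ℝ (Fin 3)) (1 / 16)) :
    π ^ 2 / 16 ≤ 4 * π ^ 2 * (1 / 16) * cos (2 * π * y 1)
      * cos (2 * π * (y 0 - 1 / 16 * sin (2 * π * y 1))) := by
  rw [Metric.mem_ball, dist_zero_right] at hy
  have hy0 : |y 0| ≤ 1 / 16 := by
    have := PiLp.norm_apply_le y 0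
    rw [Real.norm_eq_abs] at this
    linarith
  have hy1 : |y 1| ≤ 1 / 16 := by
    have := PiLp.norm_apply_le y 1
    rw [Real.norm_eq_abs] at this
    linarith
  have hπ := Real.pi_pos
  have h1 : 1 / 2 ≤ cos (2 * π * y 1) := by
    apply half_le_cos
    rw [abs_mul, abs_of_pos (by positivity : (0:ℝ) < 2 * π)]
    nlinarith
  have h2 : 1 / 2 ≤ cos (2 * π * (y 0 - 1 / 16 * sin (2 * π * y 1))) := by
    apply half_le_cos
    rw [abs_mul, abs_of_pos (by positivity : (0:ℝ) < 2 * π)]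
    have hs : |y 0 - 1 / 16 * sin (2 * π * y 1)| ≤ 1 / 8 := by
      have := abs_sin_le_one (2 * π * y 1)
      have h' : |y 0 - 1 / 16 * sin (2 * π * y 1)| ≤ |y 0| + |1 / 16 * sin (2 * π * y 1)| :=
        abs_sub _ _
      rw [abs_mul, abs_of_pos (by norm_num : (0:ℝ) < 1 / 16)] at h'
      linarith
    nlinarith
  have h12 : 1 / 4 ≤ cos (2 * π * y 1) * cos (2 * π * (y 0 - 1 / 16 * sin (2 * π * y 1))) := by
    nlinarith [mul_le_mul h1 h2 (by norm_num) ((by norm_num : (0:ℝ) ≤ 1 / 2).trans h1)]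
  nlinarith [sq_nonneg π]

/-- At time `0` the round-ball average about the origin along `−e₀` vanishes (the integrand is
identically `0`). -/
theorem ballAvg_shear_zero (R : ℝ) :
    Literature.Claims.NS.Kyritsis2022.ballAvg (curl (shear 0)) (-bv 0) 0 R = 0 := by
  unfold Literature.Claims.NS.Kyritsis2022.ballAvg
  simp_rw [inner_curl_shear_neg_bv0]
  simp

/-- At time `t = 1/16` the round-ball average of radius `1/16` about the particle position
`X(t,0) = 0` along `−e₀` is at least `π²/16 > 0`. -/
theorem le_ballAvg_shear :
    π ^ 2 / 16 ≤ Literature.Claims.NS.Kyritsis2022.ballAvg (curl (shear (1 / 16))) (-bv 0)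
      (flowX (1 / 16) 0) (1 / 16) := by
  unfold Literature.Claims.NS.Kyritsis2022.ballAvg
  rw [flowX_origin]
  simp_rw [inner_curl_shear_neg_bv0]
  set B := Metric.ball (0 : EuclideanSpace ℝ (Fin 3)) (1 / 16) with hB
  have hBpos : 0 < volume B := Metric.measure_ball_pos volume _ (by norm_num)
  have hBfin : volume B ≠ ⊤ := measure_ball_lt_top.ne
  have hreal : 0 < volume.real B := ENNReal.toReal_pos hBpos.ne' hBfin
  have hcont : Continuous fun y : EuclideanSpace ℝ (Fin 3) =>
      4 * π ^ 2 * (1 / 16) * cos (2 * π * y 1)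
        * cos (2 * π * (y 0 - 1 / 16 * sin (2 * π * y 1))) := by
    fun_prop
  have hint : IntegrableOn (fun y : EuclideanSpace ℝ (Fin 3) =>
      4 * π ^ 2 * (1 / 16) * cos (2 * π * y 1)
        * cos (2 * π * (y 0 - 1 / 16 * sin (2 * π * y 1)))) B volume :=
    (hcont.continuousOn.integrableOn_compact (isCompact_closedBall 0 (1 / 16))).mono_set
      Metric.ball_subset_closedBall
  have hge := setIntegral_ge_of_const_le_real measurableSet_ball hBfin
    (fun y hy => integrand_lower_bound hy) hint
  rw [setAverage_eq, smul_eq_mul]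
  rw [le_inv_mul_iff₀ hreal]
  linarith

/-- **`Step_10` of the typed skeleton is false.** Locator: Kyritsis 2022, proof of Thm 4.4,
passage (4.13)→(4.14), pp. 2554–2555 («as the incompressible flow is volume preserving, the
B(R, x₀) = B(R, x(tₙ)) … at the initial conditions t = 0, this average vorticity is the same
or higher than that at tₙ»), literal round-ball reading; skeleton decl
`Literature.Claims.NS.Kyritsis2022.Step_10` (consumed by `theorem44Finite_of_steps_literal`).
Countermodel: the periodic Euler shear flow (`ν = 0`), the stagnation point `x₀ = 0`
(`X(t,0) = 0`), the unit axis `−e₀`, radius `R = 1/16`, time `t = T = 1/16`: the round-ball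
average is `0` at time `0` (integrand identically zero) and at least `π²/16` at time `t`
(vortex stretching: integrand `4π²t cos(2πy₁)cos(2π(y₀ − t sin 2πy₁)) ≥ π²t` on the ball).
Axioms: propext, Classical.choice, Quot.sound. -/
theorem not_Step_10 : ¬ Literature.Claims.NS.Kyritsis2022.Step_10 := by
  intro h
  have hT : (0 : ℝ) < 1 / 16 := by norm_num
  have hle := h 0 le_rfl (1 / 16) hT shear (fun _ _ => 0)
    (isClassicalNSSolutionOn_shear (uniqueDiffOn_Icc hT)) flowX flowY (isFlowOn_shear _)
    (-bv 0) (by rw [norm_neg, norm_bv]) 0 (1 / 16) hT (1 / 16) ⟨hT.le, le_rfl⟩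
  rw [ballAvg_shear_zero] at hle
  have := le_ballAvg_shear
  nlinarith [Real.pi_gt_three]

end Summit.NavierStokesRegularity.NavierStokesRegularity.Theorems.Kyritsis2022

end
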